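import Summits.CriticalPhenomena.PercolationContinuityZ3.Theorems.SahiAEOpenBandVersion
import Summits.CriticalPhenomena.PercolationContinuityZ3.Theorems.SahiAEBandGeometry

/-!
# Planar bands are open bands: the band theorem in every dimension contains the planar band theorem

Support file of the Sahi cell (`prim-sahi`, typer seat, generation 25; `--supports stmt-CriticalPhenomena-4575`).
Theorems only (no definitions, no named facts, no sorries).

Consistency check between generations 24 and 25: every planar band (`Plane.IsBand`, `SahiAEBandGeometry.lean`) is an
open band of `ℝ²` (`IsOpenBand`, `SahiAEOpenBand.lean`), so THE BAND THEOREM IN EVERY DIMENSION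
(`exists_measurable_supermodular_version_of_ae_openBand`, `SahiAEOpenBandVersion.lean`) re-proves the planar band
theorem of `SahiAEBand.lean` (`Plane.exists_measurable_supermodular_version_of_ae_band`) by a different route
(`Plane.exists_measurable_supermodular_version_of_ae_band_of_openBand`).  No sorries, no new axioms.
-/

noncomputable section

namespace Summit.CriticalPhenomena.PercolationContinuityZ3.Theorems.SahiAEFourFunctions

open MeasureTheory Set Filter Topology Function
open scoped ENNReal NNReal

/-- **Every planar band is an open band.** [this work] -/
theorem Plane.IsBand.isOpenBand {B : Set (Fin 2 → ℝ)} (hB : Plane.IsBand B) : IsOpenBand B := by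
  refine ⟨hB.isOpen, hB.inf_mem, hB.sup_mem, fun x i => ⟨fun s hs t ht u hu => ?_⟩⟩
  have hle : update x i s ≤ update x i t := fun k => by
    by_cases hk : k = i
    · subst hk; simp [hu.1.trans hu.2]
    · simp [hk]
  have hcoord : update x i s 0 = update x i t 0 ∨ update x i s 1 = update x i t 1 := by
    fin_cases i
    · exact Or.inr (by simp)
    · exact Or.inl (by simp)
  refine hB.seg_subset _ hs _ ht hle hcoord ⟨fun k => ?_, fun k => ?_⟩
  · by_cases hk : k = i
    · subst hk; simp [hu.1]
    · simp [hk]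
  · by_cases hk : k = i
    · subst hk; simp [hu.2]
    · simp [hk]

/-- **The planar band theorem from the band theorem in every dimension** (a second, independent proof of
`Plane.exists_measurable_supermodular_version_of_ae_band`). [this work] -/
theorem Plane.exists_measurable_supermodular_version_of_ae_band_of_openBand {B : Set (Fin 2 → ℝ)}
    (hB : Plane.IsBand B) (φ : (Fin 2 → ℝ) → ℝ) (hφ : Measurable φ)
    (hsmB : ∀ᵐ q ∂(volume : Measure (Fin 2 → ℝ)).prod volume,
      q.1 ∈ B → q.2 ∈ B → φ q.1 + φ q.2 ≤ φ (q.1 ⊓ q.2) + φ (q.1 ⊔ q.2)) :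
    ∃ ψ : (Fin 2 → ℝ) → ℝ, Measurable ψ ∧ (∀ᵐ x ∂(volume : Measure (Fin 2 → ℝ)), x ∈ B → ψ x = φ x) ∧
      ∀ x ∈ B, ∀ y ∈ B, ψ x + ψ y ≤ ψ (x ⊓ y) + ψ (x ⊔ y) :=
  exists_measurable_supermodular_version_of_ae_openBand hB.isOpenBand φ hφ hsmB

/-- **The planar multiplicative band theorem from the band theorem in every dimension.** [this work] -/
theorem Plane.exists_measurable_tp2_version_of_ae_band_of_openBand {B : Set (Fin 2 → ℝ)} (hB : Plane.IsBand B)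
    (f : (Fin 2 → ℝ) → ℝ≥0∞) (hf : Measurable f)
    (hpos : ∀ᵐ x ∂(volume : Measure (Fin 2 → ℝ)), x ∈ B → f x ≠ 0 ∧ f x ≠ ∞)
    (hzero : ∀ᵐ x ∂(volume : Measure (Fin 2 → ℝ)), x ∉ B → f x = 0)
    (hMTP : ∀ᵐ q ∂(volume : Measure (Fin 2 → ℝ)).prod volume, f q.1 * f q.2 ≤ f (q.1 ⊓ q.2) * f (q.1 ⊔ q.2)) :
    ∃ F : (Fin 2 → ℝ) → ℝ≥0∞, Measurable F ∧ (∀ x ∈ B, F x ≠ 0 ∧ F x ≠ ∞) ∧ (∀ x ∉ B, F x = 0) ∧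
      F =ᵐ[(volume : Measure (Fin 2 → ℝ))] f ∧ ∀ x y, F x * F y ≤ F (x ⊓ y) * F (x ⊔ y) :=
  exists_measurable_tp2_version_of_ae_openBand hB.isOpenBand f hf hpos hzero hMTP

end Summit.CriticalPhenomena.PercolationContinuityZ3.Theorems.SahiAEFourFunctions
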